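import Summits.HodgeConjecture.HodgeConjecture.Theorems.Q8SymplecticPowersQuaternionicAdaptedBasis
import HarnessLib

/-!
# Route `Q8SymplecticPowers`, programme K2Q ∕ F-Q — brick F1C (part b): **the four block placements of `Ω⁻¹` are combinations
# of the quaternionic Casimir matrices `[d]_β [Q]_β⁻¹`, `d ∈ {1, a, b, ab}`**

Support file for crux K2Q `PowersHodgeOfQuaternionCommutators` (stmt-HodgeConjecture-24191; `--supports … --as helper`;
nothing here closes an item). Prover seat `hodge-nonav-20241-p1` (g21). Pure linear algebra over a field `K` of
characteristic `0` with `i² = −1`, in an adapted basis `β = (m_p, b m_p)` (brick F1A `Q8SymplecticPowersQuaternionicAdaptedBasis`: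
`[a] = diag(i, −i)`, `[b] = (0 −1; 1 0)`, `[Q] = (0 Ω; −Ω 0)`).

The diagonal-`Sp(Ω)` FFT (brick F1C part a, `Q8SymplecticPowersDoubledAlphabetFFT`) produces tagged contractions whose pair
matrices are `Ω⁻¹` PLACED IN ONE OF THE FOUR BLOCKS of a `(Fin k ⊕ Fin k)`-matrix. Since `V = M ⊗ K²` and
`D ⊗ K = End(K²)` for the quaternion algebra `D = ⟨1, a, b, ab⟩`, these four block placements are `K`-combinations of the
four CASIMIR MATRICES `θ_d = [d]_β · [Q]_β⁻¹` (the coordinate matrices of `(d ⊗ 1)(κ_Q)`, `κ_Q` the Casimir element of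
`Q`) — the pair matrices of the graph classes `tr(x ∪ d^* y)` consumed by A-Q `Q8SymplecticPowersMatchingClassesAlgebraic`:

* `toMatrix_Q_inv` — `[Q]_β⁻¹ = (0 −Ω⁻¹; Ω⁻¹ 0)`;
* `theta_one ∕ theta_a ∕ theta_b ∕ theta_ab` — the four Casimir matrices in block form;
* **`exists_blockPlace_eq_sum_smul_theta`** — there are coefficients `λ : Bool × Bool → Fin 4 → K` with
  `bp(Ω⁻¹)(c₁, c₂) = Σ_d λ (c₁,c₂) d • θ_d` for all four blocks (`E₁₁ = −½θ_b + ½iθ_ab`, `E₂₂ = −½θ_b − ½iθ_ab`,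
  `E₁₂ = −½θ_1 + ½iθ_a`, `E₂₁ = ½θ_1 + ½iθ_a`, all `⊗ Ω⁻¹`).

HONEST FRAMING: linear algebra only (axioms standard); item 24191 OPEN; nothing here says HC ∕ HC_CM ∕ HC_AV is proved.

## References

* R. Goodman, N. Wallach, *Symmetry, Representations, and Invariants*, GTM 255, §4.2.2 Prop. 4.2.5 (invariants of a group
  acting on one tensor factor), §11.3.5 (forms with a commuting structure). [cite: GoodmanWallachGTM255]
-/

set_option linter.dupNamespace false

noncomputable section

open Module
open scoped BigOperators Matrix

namespace Summit.HodgeConjecture.HodgeConjecture.Theorems.Q8SymplecticPowersQuaternionicCasimirBlocks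

open Summit.HodgeConjecture.HodgeConjecture.Theorems.Q8SymplecticPowersQuaternionicAdaptedBasis

universe u v

variable {K : Type u} [Field K] {V : Type v} [AddCommGroup V] [Module K V]
  {Q : LinearMap.BilinForm K V} {a b : V →ₗ[K] V} {i : K}

variable {k : ℕ} (β : Basis (Fin k ⊕ Fin k) K V) (hM : ∀ p, a (β (Sum.inl p)) = i • β (Sum.inl p))
  (hb : ∀ p, β (Sum.inr p) = b (β (Sum.inl p)))

/-- The Gram matrix `Ω_pq = Q(m_p, b m_q)` of `ω` on `M` (brick F1A). Local notation only. -/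
local notation3 (prettyPrint := false) "Ω" => (Matrix.of fun p q : Fin k => Q (β (Sum.inl p)) (β (Sum.inr q)))

/-- The block placements of a `k × k` matrix `Θ` (VERBATIM brick F1C part a). Local notation only. -/
local notation3 (prettyPrint := false) "bp[" Θ "]" =>
  (fun cc : Bool × Bool => Matrix.of fun x y : Fin k ⊕ Fin k =>
    if Sum.isLeft x = cc.1 ∧ Sum.isLeft y = cc.2 then Θ (Sum.elim id id x) (Sum.elim id id y) else (0 : K))

/-- The quaternion basis `(1, a, b, ab)` of `D ⊗ K`. Local notation only. -/
local notation3 (prettyPrint := false) "Dq" => (![(1 : V →ₗ[K] V), a, b, a * b] : Fin 4 → (V →ₗ[K] V))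

include hM hb

/-! ### §1 `[Q]_β⁻¹` and the four Casimir matrices in block form -/

/-- **`[Q]_β⁻¹ = (0 −Ω⁻¹; Ω⁻¹ 0)`.** [cite: GoodmanWallachGTM255, §11.3.5] -/
theorem toMatrix_Q_inv [CharZero K] (hQs : ∀ x y, Q x y = Q y x) (hQn : Q.Nondegenerate)
    (haa : ∀ x, a (a x) = -x) (hbb : ∀ x, b (b x) = -x) (hab : ∀ x, a (b x) = -b (a x))
    (haQ : ∀ x y, Q (a x) (a y) = Q x y) (hQb : ∀ x y, Q (b x) (b y) = Q x y) (hi : i * i = -1) :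
    (LinearMap.BilinForm.toMatrix β Q)⁻¹ = Matrix.fromBlocks 0 (-(Ω)⁻¹) (Ω)⁻¹ 0 := by
  have hΩ := isUnit_det_omega β hM hb hQs hQn haa hbb hab haQ hi
  rw [toMatrix_Q β hM hb hQs hbb hab haQ hQb hi]
  set W : Matrix (Fin k) (Fin k) K := Ω with hW
  apply Matrix.inv_eq_right_inv
  rw [Matrix.fromBlocks_multiply]
  simp only [Matrix.zero_mul, Matrix.mul_zero, zero_add, add_zero, Matrix.neg_mul, Matrix.mul_neg, neg_neg,
    neg_zero, Matrix.mul_nonsing_inv _ hΩ, Matrix.fromBlocks_one]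

/-- `θ_1 = [1]_β [Q]_β⁻¹ = (0 −Ω⁻¹; Ω⁻¹ 0)`. [cite: GoodmanWallachGTM255, §11.3.5] -/
theorem theta_one [CharZero K] (hQs : ∀ x y, Q x y = Q y x) (hQn : Q.Nondegenerate)
    (haa : ∀ x, a (a x) = -x) (hbb : ∀ x, b (b x) = -x) (hab : ∀ x, a (b x) = -b (a x))
    (haQ : ∀ x y, Q (a x) (a y) = Q x y) (hQb : ∀ x y, Q (b x) (b y) = Q x y) (hi : i * i = -1) :
    LinearMap.toMatrix β β (Dq 0) * (LinearMap.BilinForm.toMatrix β Q)⁻¹ = Matrix.fromBlocks 0 (-(Ω)⁻¹) (Ω)⁻¹ 0 := by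
  rw [show (Dq 0) = 1 from rfl, LinearMap.toMatrix_one, Matrix.one_mul, toMatrix_Q_inv β hM hb hQs hQn haa hbb hab haQ hQb hi]

/-- `θ_a = [a]_β [Q]_β⁻¹ = (0 −iΩ⁻¹; −iΩ⁻¹ 0)`. [cite: GoodmanWallachGTM255, §11.3.5] -/
theorem theta_a [CharZero K] (hQs : ∀ x y, Q x y = Q y x) (hQn : Q.Nondegenerate)
    (haa : ∀ x, a (a x) = -x) (hbb : ∀ x, b (b x) = -x) (hab : ∀ x, a (b x) = -b (a x))
    (haQ : ∀ x y, Q (a x) (a y) = Q x y) (hQb : ∀ x y, Q (b x) (b y) = Q x y) (hi : i * i = -1) :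
    LinearMap.toMatrix β β (Dq 1) * (LinearMap.BilinForm.toMatrix β Q)⁻¹ =
      Matrix.fromBlocks 0 (-(i • (Ω)⁻¹)) (-(i • (Ω)⁻¹)) 0 := by
  rw [show (Dq 1) = a from rfl, toMatrix_a β hM hb hab, toMatrix_Q_inv β hM hb hQs hQn haa hbb hab haQ hQb hi,
    Matrix.fromBlocks_multiply]
  simp

/-- `θ_b = [b]_β [Q]_β⁻¹ = (−Ω⁻¹ 0; 0 −Ω⁻¹)`. [cite: GoodmanWallachGTM255, §11.3.5] -/
theorem theta_b [CharZero K] (hQs : ∀ x y, Q x y = Q y x) (hQn : Q.Nondegenerate)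
    (haa : ∀ x, a (a x) = -x) (hbb : ∀ x, b (b x) = -x) (hab : ∀ x, a (b x) = -b (a x))
    (haQ : ∀ x y, Q (a x) (a y) = Q x y) (hQb : ∀ x y, Q (b x) (b y) = Q x y) (hi : i * i = -1) :
    LinearMap.toMatrix β β (Dq 2) * (LinearMap.BilinForm.toMatrix β Q)⁻¹ = Matrix.fromBlocks (-(Ω)⁻¹) 0 0 (-(Ω)⁻¹) := by
  rw [show (Dq 2) = b from rfl, toMatrix_b β hb hbb, toMatrix_Q_inv β hM hb hQs hQn haa hbb hab haQ hQb hi,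
    Matrix.fromBlocks_multiply]
  simp

/-- `θ_ab = [ab]_β [Q]_β⁻¹ = (−iΩ⁻¹ 0; 0 iΩ⁻¹)`. [cite: GoodmanWallachGTM255, §11.3.5] -/
theorem theta_ab [CharZero K] (hQs : ∀ x y, Q x y = Q y x) (hQn : Q.Nondegenerate)
    (haa : ∀ x, a (a x) = -x) (hbb : ∀ x, b (b x) = -x) (hab : ∀ x, a (b x) = -b (a x))
    (haQ : ∀ x y, Q (a x) (a y) = Q x y) (hQb : ∀ x y, Q (b x) (b y) = Q x y) (hi : i * i = -1) :
    LinearMap.toMatrix β β (Dq 3) * (LinearMap.BilinForm.toMatrix β Q)⁻¹ =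
      Matrix.fromBlocks (-(i • (Ω)⁻¹)) 0 0 (i • (Ω)⁻¹) := by
  rw [show (Dq 3) = a * b from rfl, LinearMap.toMatrix_mul, toMatrix_a β hM hb hab, toMatrix_b β hb hbb,
    toMatrix_Q_inv β hM hb hQs hQn haa hbb hab haQ hQb hi, Matrix.fromBlocks_multiply, Matrix.fromBlocks_multiply]
  simp

/-! ### §2 The block placements of `Ω⁻¹` as combinations of the Casimir matrices -/

omit hM hb in
/-- The block placements of `Θ`, as `fromBlocks`. [cite: GoodmanWallachGTM255, §4.2.2] -/
theorem blockPlace_eq_fromBlocks (Θ : Matrix (Fin k) (Fin k) K) :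
    bp[Θ] (true, true) = Matrix.fromBlocks Θ 0 0 0 ∧ bp[Θ] (true, false) = Matrix.fromBlocks 0 Θ 0 0 ∧
      bp[Θ] (false, true) = Matrix.fromBlocks 0 0 Θ 0 ∧ bp[Θ] (false, false) = Matrix.fromBlocks 0 0 0 Θ := by
  refine ⟨?_, ?_, ?_, ?_⟩ <;>
  · ext x y
    rcases x with p | p <;> rcases y with q | q <;> simp

/-- **The four block placements of `Ω⁻¹` are `K`-combinations of the Casimir matrices `θ_d = [d]_β [Q]_β⁻¹`,
`d ∈ {1, a, b, ab}`** (`D ⊗ K = End(K²)`): explicitly `E₁₁⊗Ω⁻¹ = −½θ_b + ½iθ_ab`, `E₁₂⊗Ω⁻¹ = −½θ_1 + ½iθ_a`,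
`E₂₁⊗Ω⁻¹ = ½θ_1 + ½iθ_a`, `E₂₂⊗Ω⁻¹ = −½θ_b − ½iθ_ab`. [cite: GoodmanWallachGTM255, §4.2.2 Prop. 4.2.5 and §11.3.5] -/
theorem exists_blockPlace_eq_sum_smul_theta [CharZero K] (hQs : ∀ x y, Q x y = Q y x) (hQn : Q.Nondegenerate)
    (haa : ∀ x, a (a x) = -x) (hbb : ∀ x, b (b x) = -x) (hab : ∀ x, a (b x) = -b (a x))
    (haQ : ∀ x y, Q (a x) (a y) = Q x y) (hQb : ∀ x y, Q (b x) (b y) = Q x y) (hi : i * i = -1) :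
    ∃ lam : Bool × Bool → Fin 4 → K, ∀ cc : Bool × Bool,
      bp[(Ω)⁻¹] cc = ∑ d : Fin 4, lam cc d • (LinearMap.toMatrix β β (Dq d) * (LinearMap.BilinForm.toMatrix β Q)⁻¹) := by
  have h1 := theta_one β hM hb hQs hQn haa hbb hab haQ hQb hi
  have ha := theta_a β hM hb hQs hQn haa hbb hab haQ hQb hi
  have hb' := theta_b β hM hb hQs hQn haa hbb hab haQ hQb hi
  have hab' := theta_ab β hM hb hQs hQn haa hbb hab haQ hQb hi
  obtain ⟨htt, htf, hft, hff⟩ := blockPlace_eq_fromBlocks (K := K) (k := k) (Ω)⁻¹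
  set W : Matrix (Fin k) (Fin k) K := (Ω)⁻¹ with hW
  -- the scalar identities `½ + ½ (−i²) = 1`, `½ − ½(−i²)… = 0`
  have e1 : (-(2 : K)⁻¹) * (-1) + (i * 2⁻¹) * (-i) = 1 := by
    have h2 : (2 : K) * 2⁻¹ = 1 := mul_inv_cancel₀ two_ne_zero
    linear_combination (-(2 : K)⁻¹) * hi + h2
  have e2 : (-(2 : K)⁻¹) * (-1) + (i * 2⁻¹) * i = 0 := by
    linear_combination ((2 : K)⁻¹) * hi
  have e3 : (-(2 : K)⁻¹) * (-1) + -(i * 2⁻¹) * (-i) = 0 := by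
    linear_combination ((2 : K)⁻¹) * hi
  have e4 : (-(2 : K)⁻¹) * (-1) + -(i * 2⁻¹) * i = 1 := by
    have h2 : (2 : K) * 2⁻¹ = 1 := mul_inv_cancel₀ two_ne_zero
    linear_combination (-(2 : K)⁻¹) * hi + h2
  have e5 : ((2 : K)⁻¹) * (-1) + (i * 2⁻¹) * (-i) = 0 := by
    linear_combination (-(2 : K)⁻¹) * hi
  have e6 : ((2 : K)⁻¹) * 1 + (i * 2⁻¹) * (-i) = 1 := by
    have h2 : (2 : K) * 2⁻¹ = 1 := mul_inv_cancel₀ two_ne_zero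
    linear_combination (-(2 : K)⁻¹) * hi + h2
  have e7 : (-(2 : K)⁻¹) * (-1) + (i * 2⁻¹) * (-i) = 1 := e1
  have e8 : (-(2 : K)⁻¹) * 1 + (i * 2⁻¹) * (-i) = 0 := by
    linear_combination (-(2 : K)⁻¹) * hi
  refine ⟨fun cc => if cc.1 then (if cc.2 then ![0, 0, -(2 : K)⁻¹, i * 2⁻¹] else ![-(2 : K)⁻¹, i * 2⁻¹, 0, 0])
    else (if cc.2 then ![(2 : K)⁻¹, i * 2⁻¹, 0, 0] else ![0, 0, -(2 : K)⁻¹, -(i * 2⁻¹)]), fun cc => ?_⟩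
  obtain ⟨c₁, c₂⟩ := cc
  rw [Fin.sum_univ_four, h1, ha, hb', hab']
  cases c₁ <;> cases c₂
  · -- `(false, false)`: `E₂₂ ⊗ Ω⁻¹`
    rw [hff]
    simp only [Bool.false_eq_true, if_false, Matrix.cons_val_zero, Matrix.cons_val_one, Matrix.head_cons,
      Matrix.cons_val_two, Matrix.tail_cons, Matrix.cons_val_three, zero_smul, zero_add, Matrix.fromBlocks_smul,
      Matrix.fromBlocks_add, smul_zero, add_zero]
    refine Matrix.fromBlocks_inj.2 ⟨?_, rfl, rfl, ?_⟩
    · ext p q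
      simp only [Matrix.add_apply, Matrix.smul_apply, Matrix.neg_apply, smul_eq_mul, Matrix.zero_apply]
      linear_combination (-(W p q)) * e3
    · ext p q
      simp only [Matrix.add_apply, Matrix.smul_apply, Matrix.neg_apply, smul_eq_mul]
      linear_combination (-(W p q)) * e4
  · -- `(false, true)`: `E₂₁ ⊗ Ω⁻¹`
    rw [hft]
    simp only [Bool.false_eq_true, if_false, if_true, Matrix.cons_val_zero, Matrix.cons_val_one, Matrix.head_cons,
      Matrix.cons_val_two, Matrix.tail_cons, Matrix.cons_val_three, zero_smul, Matrix.fromBlocks_smul,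
      Matrix.fromBlocks_add, smul_zero, add_zero]
    refine Matrix.fromBlocks_inj.2 ⟨rfl, ?_, ?_, rfl⟩
    · ext p q
      simp only [Matrix.add_apply, Matrix.smul_apply, Matrix.neg_apply, smul_eq_mul, Matrix.zero_apply]
      linear_combination (-(W p q)) * e5
    · ext p q
      simp only [Matrix.add_apply, Matrix.smul_apply, Matrix.neg_apply, smul_eq_mul]
      linear_combination (-(W p q)) * e6
  · -- `(true, false)`: `E₁₂ ⊗ Ω⁻¹`
    rw [htf]
    simp only [if_true, Bool.false_eq_true, if_false, Matrix.cons_val_zero, Matrix.cons_val_one, Matrix.head_cons,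
      Matrix.cons_val_two, Matrix.tail_cons, Matrix.cons_val_three, zero_smul, Matrix.fromBlocks_smul,
      Matrix.fromBlocks_add, smul_zero, add_zero]
    refine Matrix.fromBlocks_inj.2 ⟨rfl, ?_, ?_, rfl⟩
    · ext p q
      simp only [Matrix.add_apply, Matrix.smul_apply, Matrix.neg_apply, smul_eq_mul]
      linear_combination (-(W p q)) * e7
    · ext p q
      simp only [Matrix.add_apply, Matrix.smul_apply, Matrix.neg_apply, smul_eq_mul, Matrix.zero_apply]
      linear_combination (-(W p q)) * e8
  · -- `(true, true)`: `E₁₁ ⊗ Ω⁻¹`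
    rw [htt]
    simp only [if_true, Matrix.cons_val_zero, Matrix.cons_val_one, Matrix.head_cons, Matrix.cons_val_two,
      Matrix.tail_cons, Matrix.cons_val_three, zero_smul, zero_add, Matrix.fromBlocks_smul, Matrix.fromBlocks_add,
      smul_zero, add_zero]
    refine Matrix.fromBlocks_inj.2 ⟨?_, rfl, rfl, ?_⟩
    · ext p q
      simp only [Matrix.add_apply, Matrix.smul_apply, Matrix.neg_apply, smul_eq_mul]
      linear_combination (-(W p q)) * e1
    · ext p q
      simp only [Matrix.add_apply, Matrix.smul_apply, Matrix.neg_apply, smul_eq_mul, Matrix.zero_apply]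
      linear_combination (-(W p q)) * e2

end Summit.HodgeConjecture.HodgeConjecture.Theorems.Q8SymplecticPowersQuaternionicCasimirBlocks

end
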